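import Literature.Topology.FourManifolds.GroupTrisectionsConnectSum
import Literature.Topology.FourManifolds.TrisectionStabilizationDatum
import HarnessLib

/-!
# The `π₁` stage of a connected-sum step of trisections (in particular of ONE unbalanced
# stabilisation / implant), with the free-basis datum handed on

Topic `Literature/Topology/FourManifolds`; fact seat
`provefact-Literature.Topology.FourManifolds.sphere-99d675ea90` (named fact (d′)
`Literature.Topology.FourManifolds.sphere_gkTrisections`), also serving
`provefact-Literature.Topology.FourManifolds.exists-14560f9fc8` ((c′)
`Literature.Topology.FourManifolds.exists_stabilized_gkTrisection`).  Everything in this file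
is **proved**; there are no definitions and no named facts.

`TrisectionFunctorGKStabilizationPi1.lean` computes the kernel triple of a stabilised
trisection ON THE NOSE from a closed-cover decomposition of the new central surface
`F′ = A ∪_C P` (`P ≅ Σ₃ ∖ disc`) and of the new handlebodies, for the BALANCED stabilisation
(genus `g ↦ g + 3`, model triple `s4Kernels`).  The tree's geometric stabilisation is built from
three implants (`TriNormalForm.exists_stabilization`, one unbalanced stabilisation each, genus
`g ↦ g + 1`), and `GroupTrisectionsConnectSum.lean` shows
`K.stabilize = ((K.stabilizeOne 2).stabilizeOne 1).stabilizeOne 0`.  This file is the `π₁`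
stage for a general connected-sum step — genus `g ↦ g + g'`, new piece `P ≅ Σ_{g'} ∖ disc`, any
model triple `L : TrisectionKernels g'` — so that it applies verbatim to one implant
(`g' = 1`, `L = unbalancedKernels i`) and recovers the balanced case (`g' = 3`, `L = s4Kernels`):

* `exists_marking_of_closed_cover_collars_add` — the marking `μ′ : S_{g+g'} ≃* π₁(A ∪ P, x₀)`
  from free bases `θ_A` (seam reads `r_g`) and `θ_P` (seam reads `r_{g'}⁻¹`), by Seifert–van
  Kampen (`VanKampen.existsUnique_hom_of_closed_cover_collars`) and
  `surfaceGroup_exists_mulEquiv_of_pushout_add`;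
* `comap_ker_eq_connectSum_of_closed_covers` — one kernel slot: with the new handlebody a closed
  cover `A^H ∪_E B^H` over a disc `E`, `π₁ A → π₁ A^H` onto, `π₁ A^H → π₁ H` injective,
  `π₁ P → π₁ B^H` onto with kernel `mk⁻¹ L_i` (read through `θ_P`):
  `μ′⁻¹(ker) = (K # L)_i` (`surfaceGroup_ker_eq_connectSum`);
* `exists_marking_groupGKTrisectionOf_eq_connectSum` — assembled over `IsGKTrisection`:
  `𝒢(h′, x₀, μ′) = 𝒢(h, x₀, μ₀) # L` on the nose;
* `marking_comp_mk_eq_inclHom_comp_freeBasis_add`,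
  `exists_marking_groupGKTrisectionOf_eq_connectSum_datum` — the same step RETURNING THE DATUM
  for the next one (a free basis `θ′` of `π₁(A ∪ Q, x₀)`, `Q = P ∖` next open disc, through
  which `μ′` reads), as in `TrisectionStabilizationDatum.lean`;
* `exists_marking_groupGKTrisectionOf_eq_stabilizeOne_datum` — **one implant**: `g' = 1`,
  `P` a one-holed torus with free basis `θ_P : F⟨a, b⟩ ≃* π₁(P, x₀)`, `θ_P([a, b]) = t⁻¹`, and
  `π₁ P → π₁ B^H_ι` onto with kernel normally generated by `b` (slot `ι = i`) or `a`
  (`ι ≠ i`) and `[a, b]`: then `𝒢(h′, x₀, μ′) = 𝒢(h, x₀, μ₀).stabilizeOne i`, with the datum;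
* `groupGKTrisectionOf_eq_stabilize_of_three` — bookkeeping: three such steps in sectors
  `2, 1, 0` give `𝒢 = 𝒢₀.stabilize` (`TrisectionKernels.stabilize_eq_stabilizeOne`), the
  on-the-nose identity consumed by `sphere_gkTrisections_of_invariant_step`.
* `sphere_gkTrisections_of_invariant_stabilizeOne_step` — (d′) from an on-the-nose unbalanced
  step preserving any invariant `Good` (three steps in sectors `2, 1, 0`, then
  `sphere_gkTrisections_of_invariant_step`);
* `ker_eq_normalClosure_of_apply_of_eq_one_of_injective_zpow` — adapter producing the
  two-generator kernel hypothesis `hkP` of one implant from "one basis loop dies, the other has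
  infinite order" in `π₁` of the handlebody chunk.

What remains geometric (the (c′) seat's implant): the pieces `A, P, C, A^H_ι, B^H_ι, E_ι, Q`
of ONE implant inside a chart box with their collars and path-connectedness, the free basis
`θ_P` of the one-holed torus with its seam reading, `π₁ E_ι = 1`, the bite injectivity
(`TrisectionStabilizationBite.lean`) and the two-generator kernel of `π₁ P → π₁ B^H_ι`.

## References

* D. Gay, R. Kirby, *Trisecting 4-manifolds*, Geom. Topol. 20 (2016) 3097–3132
  (arXiv:1205.1565): Def. 8, Lemma 10 and its proof (arXiv pp. 31–32: one eye at a time).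
  [GayKirby2016]
* A. Abrams, D. Gay, R. Kirby, *Group trisections and smooth 4-manifolds*, Geom. Topol. 22
  (2018) 1537–1545: Def. 2–3 (pp. 1539–1540), Thm. 5 (p. 1541). [AbramsGayKirby2018]
* A. Hatcher, *Algebraic Topology*, CUP (2002): Thm. 1.20, Prop. 1.26, §1.2 p. 51.
  [HatcherAT2002]
-/

noncomputable section

open Set Subgroup
open Literature.AlgebraicTopology.FundamentalGroup.VanKampen
open scoped Manifold ContDiff

namespace Literature.Topology.FourManifolds

universe u

/-! ### The marking of `A ∪_C P` for a genus-`g'` piece `P` -/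

section Marking

variable {X : Type u} [TopologicalSpace X] {g g' : ℕ}

/-- **The marking of the new central surface `F′ = A ∪_C P`, `P ≅ Σ_{g'} ∖ disc`.**  Let
`A, P ⊆ X` be closed, meeting exactly in `C ∋ x₀`, with collars of `C` on both sides, `A`, `P`,
`C` path connected, `π₁(C, x₀)` generated by `t`; let `θ_A : F⟨a₁,…,b_g⟩ ≃* π₁(A, x₀)` and
`θ_P : F⟨a₁,…,b_{g'}⟩ ≃* π₁(P, x₀)` be free bases with `θ_A(r_g) = t` and `θ_P(r_{g'}) = t⁻¹`.
Then for every `W = A ∪ P` there is `μ′ : S_{g+g'} ≃* π₁(W, x₀)` reading the first `g`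
handles through `θ_A` and the last `g'` through `θ_P` (Seifert–van Kampen and
`surfaceGroup_exists_mulEquiv_of_pushout_add`).
[cite: HatcherAT2002, Thm. 1.20 and §1.2 p. 51] [cite: AbramsGayKirby2018, Def. 2 (p. 1539)] -/
theorem exists_marking_of_closed_cover_collars_add {A P C CA CP OA OP W : Set X}
    (hA : IsClosed A) (hP : IsClosed P) (hCA : C ⊆ A) (hCP : C ⊆ P) (hC : A ∩ P ⊆ C)
    (hOA : IsOpen OA) (hCAe : CA = A ∩ OA) (hCCA : C ⊆ CA)
    (hOP : IsOpen OP) (hCPe : CP = P ∩ OP) (hCCP : C ⊆ CP)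
    (hsdrA : Literature.AlgebraicTopology.Homotopy.IsStrongDeformationRetractOf C CA)
    (hsdrP : Literature.AlgebraicTopology.Homotopy.IsStrongDeformationRetractOf C CP)
    (hApc : IsPathConnected A) (hPpc : IsPathConnected P) (hCpc : IsPathConnected C)
    {x₀ : X} (hx₀ : x₀ ∈ C) (eW : A ∪ P = W)
    (t : _root_.FundamentalGroup C ⟨x₀, hx₀⟩) (ht : Subgroup.closure {t} = ⊤)
    (θA : FreeGroup (surfaceGen g) ≃* _root_.FundamentalGroup A ⟨x₀, hCA hx₀⟩)
    (θP : FreeGroup (surfaceGen g') ≃* _root_.FundamentalGroup P ⟨x₀, hCP hx₀⟩)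
    (hθA : θA (surfaceRelator g) = inclHomOfSubset hCA x₀ hx₀ (hCA hx₀) t)
    (hθP : θP (surfaceRelator g') = (inclHomOfSubset hCP x₀ hx₀ (hCP hx₀) t)⁻¹) :
    ∃ (hxW : x₀ ∈ W) (hAW : A ⊆ W) (hPW : P ⊆ W)
      (μ' : SurfaceGroup (g + g') ≃* _root_.FundamentalGroup W ⟨x₀, hxW⟩),
      μ'.toMonoidHom.comp ((PresentedGroup.mk _).comp (genInclAdd g g')) =
          (inclHomOfSubset hAW x₀ (hCA hx₀) hxW).comp θA.toMonoidHom ∧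
        μ'.toMonoidHom.comp ((PresentedGroup.mk _).comp (genShiftAdd g g')) =
          (inclHomOfSubset hPW x₀ (hCP hx₀) hxW).comp θP.toMonoidHom := by
  subst eW
  have hxA : x₀ ∈ A := hCA hx₀
  have hxP : x₀ ∈ P := hCP hx₀
  have hxW : x₀ ∈ A ∪ P := Or.inl hxA
  refine ⟨hxW, subset_union_left, subset_union_right, ?_⟩
  -- the two legs of the span, read in `π₁(A ∪ P)`
  set u : FreeGroup (surfaceGen g) →* _root_.FundamentalGroup ↥(A ∪ P) ⟨x₀, hxW⟩ :=
    (inclHomOfSubset (subset_union_left : A ⊆ A ∪ P) x₀ hxA hxW).comp θA.toMonoidHom with hu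
  set v : FreeGroup (surfaceGen g') →* _root_.FundamentalGroup ↥(A ∪ P) ⟨x₀, hxW⟩ :=
    (inclHomOfSubset (subset_union_right : P ⊆ A ∪ P) x₀ hxP hxW).comp θP.toMonoidHom with hv
  -- the seam relation `u(r_g) · v(r_{g'}) = 1`
  have huv : u (surfaceRelator g) * v (surfaceRelator g') = 1 := by
    rw [hu, hv, MonoidHom.comp_apply, MonoidHom.comp_apply, MulEquiv.coe_toMonoidHom,
      MulEquiv.coe_toMonoidHom, hθA, hθP, map_inv,
      inclHomOfSubset_inclHomOfSubset hCA subset_union_left hx₀ hxA hxW,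
      inclHomOfSubset_inclHomOfSubset hCP subset_union_right hx₀ hxP hxW, mul_inv_cancel]
  -- the cone into `S_{g+g'}`
  let φ₁ : _root_.FundamentalGroup A ⟨x₀, hxA⟩ →* SurfaceGroup (g + g') :=
    ((PresentedGroup.mk _).comp (genInclAdd g g')).comp θA.symm.toMonoidHom
  let φ₂ : _root_.FundamentalGroup P ⟨x₀, hxP⟩ →* SurfaceGroup (g + g') :=
    ((PresentedGroup.mk _).comp (genShiftAdd g g')).comp θP.symm.toMonoidHom
  have hφ₁ : φ₁.comp θA.toMonoidHom = (PresentedGroup.mk _).comp (genInclAdd g g') :=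
    MonoidHom.ext fun x => by simp [φ₁]
  have hφ₂ : φ₂.comp θP.toMonoidHom = (PresentedGroup.mk _).comp (genShiftAdd g g') :=
    MonoidHom.ext fun x => by simp [φ₂]
  have compat : φ₁.comp (inclHomOfSubset hCA x₀ hx₀ hxA) =
      φ₂.comp (inclHomOfSubset hCP x₀ hx₀ hxP) := by
    refine MonoidHom.eq_of_eqOn_dense ht ?_
    intro s hs
    rw [Set.mem_singleton_iff] at hs
    subst hs
    have h1 : θA.symm (inclHomOfSubset hCA x₀ hx₀ hxA s) = surfaceRelator g := by
      rw [MulEquiv.symm_apply_eq, hθA]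
    have h2 : θP.symm (inclHomOfSubset hCP x₀ hx₀ hxP s) = (surfaceRelator g')⁻¹ := by
      rw [MulEquiv.symm_apply_eq, map_inv, hθP, inv_inv]
    change PresentedGroup.mk _ (genInclAdd g g' (θA.symm (inclHomOfSubset hCA x₀ hx₀ hxA s))) =
      PresentedGroup.mk _ (genShiftAdd g g' (θP.symm (inclHomOfSubset hCP x₀ hx₀ hxP s)))
    rw [h1, h2, map_inv, map_inv, eq_inv_iff_mul_eq_one]
    exact mk_genInclAdd_surfaceRelator_mul_mk_genShiftAdd g g'
  obtain ⟨Φ, ⟨hΦ₁, hΦ₂⟩, -⟩ := existsUnique_hom_of_closed_cover_collars hA hP hCA hCP hC hOA hCAe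
    hCCA hOP hCPe hCCP hsdrA hsdrP hApc hPpc hCpc hx₀ φ₁ φ₂ compat
  -- `S_{g+g'}` is the pushout
  refine surfaceGroup_exists_mulEquiv_of_pushout_add u v huv ⟨Φ, ?_, ?_⟩ ?_
  · rw [hu, ← MonoidHom.comp_assoc, hΦ₁, hφ₁]
  · rw [hv, ← MonoidHom.comp_assoc, hΦ₂, hφ₂]
  · intro F F' hFu hFv
    have hθAs : Function.Surjective θA.toMonoidHom := θA.surjective
    have hθPs : Function.Surjective θP.toMonoidHom := θP.surjective
    refine hom_ext_of_closed_cover_collars hA hP hCA hCP hC hOA hCAe hCCA hOP hCPe hCCP hsdrA hsdrP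
      hApc hPpc hCpc hx₀ ?_ ?_
    · rw [← MonoidHom.cancel_right hθAs, MonoidHom.comp_assoc, MonoidHom.comp_assoc]
      exact hFu
    · rw [← MonoidHom.cancel_right hθPs, MonoidHom.comp_assoc, MonoidHom.comp_assoc]
      exact hFv

end Marking

/-! ### One kernel slot: `μ′⁻¹(ker) = (K # L)_i` -/

section Slot

variable {X : Type u} [TopologicalSpace X] {g g' : ℕ}

/-- **One kernel slot of a connected-sum step, from the closed pieces.**  Sets: `W₀ ⊆ V₀` (old
central surface in the old handlebody), `A ⊆ W₀`, `W ⊆ V` (new central surface in the new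
handlebody), `V = A^H ∪ B^H` a closed cover meeting exactly in `E ∋ x₀` with collars, `A^H`,
`B^H`, `E` path connected and `π₁(E, x₀) = 1` (a disc), `A ⊆ A^H ⊆ V₀`, `P ⊆ B^H`.  Markings:
`μ₀ : S_g ≃* π₁(W₀, x₀)` reading words through `θ_A`, and `μ′ : S_{g+g'} ≃* π₁(W, x₀)` reading
the first `g` handles through `θ_A` and the last `g'` through `θ_P`.  Geometric `π₁` inputs:
`π₁ A → π₁ A^H` onto (on the image of `θ_A`), `π₁ A^H → π₁ V₀` injective, `π₁ P → π₁ B^H`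
onto (on the image of `θ_P`) with kernel, read in the free group, the full preimage of the model
kernel `L_i ⊆ S_{g'}`.  Conclusion: `μ′⁻¹ (ker (π₁ W → π₁ V)) = (K # L)_i` for any `K` with
`K_i = μ₀⁻¹ (ker (π₁ W₀ → π₁ V₀))` (van Kampen across `E`, then `surfaceGroup_ker_eq_connectSum`).
[cite: AbramsGayKirby2018, Def. 2–3 (pp. 1539–1540)] [cite: GayKirby2016, Def. 8 and Lemma 10] -/
theorem comap_ker_eq_connectSum_of_closed_covers
    {A P W W₀ V₀ AH BH E CA CB OA OB V : Set X} {x₀ : X}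
    -- the new handlebody as a closed cover `V = A^H ∪ B^H` glued along the disc `E`
    (hAH : IsClosed AH) (hBH : IsClosed BH) (hEAH : E ⊆ AH) (hEBH : E ⊆ BH) (hE : AH ∩ BH ⊆ E)
    (hOA : IsOpen OA) (hCAe : CA = AH ∩ OA) (hECA : E ⊆ CA)
    (hOB : IsOpen OB) (hCBe : CB = BH ∩ OB) (hECB : E ⊆ CB)
    (hsdrA : Literature.AlgebraicTopology.Homotopy.IsStrongDeformationRetractOf E CA)
    (hsdrB : Literature.AlgebraicTopology.Homotopy.IsStrongDeformationRetractOf E CB)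
    (hAHpc : IsPathConnected AH) (hBHpc : IsPathConnected BH) (hEpc : IsPathConnected E)
    (hx₀E : x₀ ∈ E) [Subsingleton (_root_.FundamentalGroup E ⟨x₀, hx₀E⟩)] (eV : AH ∪ BH = V)
    -- positions of the pieces
    (hxA : x₀ ∈ A) (hxP : x₀ ∈ P) (hAW₀ : A ⊆ W₀) (hW₀V₀ : W₀ ⊆ V₀) (hAAH : A ⊆ AH)
    (hAHV₀ : AH ⊆ V₀) (hPBH : P ⊆ BH) (hAW : A ⊆ W) (hPW : P ⊆ W) (hWV : W ⊆ V)
    -- markings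
    (θA : FreeGroup (surfaceGen g) →* _root_.FundamentalGroup A ⟨x₀, hxA⟩)
    (θP : FreeGroup (surfaceGen g') →* _root_.FundamentalGroup P ⟨x₀, hxP⟩)
    (μ₀ : SurfaceGroup g ≃* _root_.FundamentalGroup W₀ ⟨x₀, hAW₀ hxA⟩)
    (hμ₀ : μ₀.toMonoidHom.comp (PresentedGroup.mk _) = (inclHomOfSubset hAW₀ x₀ hxA (hAW₀ hxA)).comp θA)
    (μ' : SurfaceGroup (g + g') ≃* _root_.FundamentalGroup W ⟨x₀, hAW hxA⟩)
    (hμ'A : μ'.toMonoidHom.comp ((PresentedGroup.mk _).comp (genInclAdd g g')) =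
      (inclHomOfSubset hAW x₀ hxA (hAW hxA)).comp θA)
    (hμ'P : μ'.toMonoidHom.comp ((PresentedGroup.mk _).comp (genShiftAdd g g')) =
      (inclHomOfSubset hPW x₀ hxP (hAW hxA)).comp θP)
    -- the old kernel and the model kernel
    (K : TrisectionKernels g) (L : TrisectionKernels g') (i : Fin 3)
    (hK : K i = ((inclHomOfSubset hW₀V₀ x₀ (hAW₀ hxA) (hW₀V₀ (hAW₀ hxA))).ker).comap μ₀.toMonoidHom)
    -- the geometric `π₁` inputs
    (hsA : Function.Surjective ((inclHomOfSubset hAAH x₀ hxA (hAAH hxA)).comp θA))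
    (hjA : Function.Injective (inclHomOfSubset hAHV₀ x₀ (hAAH hxA) (hAHV₀ (hAAH hxA))))
    (hsP : Function.Surjective ((inclHomOfSubset hPBH x₀ hxP (hPBH hxP)).comp θP))
    (hkP : (((inclHomOfSubset hPBH x₀ hxP (hPBH hxP)).comp θP).ker : Set (FreeGroup (surfaceGen g'))) =
      (PresentedGroup.mk _) ⁻¹' (L i : Set (SurfaceGroup g'))) :
    ((inclHomOfSubset hWV x₀ (hAW hxA) (hWV (hAW hxA))).ker).comap μ'.toMonoidHom =
      K.connectSum L i := by
  subst eV
  have hxAH : x₀ ∈ AH := hAAH hxA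
  have hxBH : x₀ ∈ BH := hPBH hxP
  have hxV : x₀ ∈ AH ∪ BH := hWV (hAW hxA)
  -- `π₁ V = π₁ A^H ∗ π₁ B^H` (van Kampen across the disc `E`)
  have hcop : ∀ (T : Type) [Group T] (f : _root_.FundamentalGroup AH ⟨x₀, hxAH⟩ →* T)
      (f' : _root_.FundamentalGroup BH ⟨x₀, hxBH⟩ →* T),
      ∃ Φ : _root_.FundamentalGroup ↥(AH ∪ BH) ⟨x₀, hxV⟩ →* T,
        Φ.comp (inclHomOfSubset (subset_union_left : AH ⊆ AH ∪ BH) x₀ hxAH hxV) = f ∧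
          Φ.comp (inclHomOfSubset (subset_union_right : BH ⊆ AH ∪ BH) x₀ hxBH hxV) = f' :=
    fun T _ f f' => exists_hom_of_closed_cover_collars_of_subsingleton hAH hBH hEAH hEBH hE hOA hCAe
      hECA hOB hCBe hECB hsdrA hsdrB hAHpc hBHpc hEpc hx₀E f f'
  rw [MonoidHom.comap_ker]
  refine surfaceGroup_ker_eq_connectSum K L i _
    (inclHomOfSubset (subset_union_left : AH ⊆ AH ∪ BH) x₀ hxAH hxV)
    (inclHomOfSubset (subset_union_right : BH ⊆ AH ∪ BH) x₀ hxBH hxV) hcop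
    ((inclHomOfSubset hAAH x₀ hxA hxAH).comp θA) ((inclHomOfSubset hPBH x₀ hxP hxBH).comp θP)
    hsA hsP ?_ hkP ?_ ?_
  · -- the old kernel, read on `π₁ A → π₁ A^H ↪ π₁ V₀`
    rw [hK]
    exact ker_comp_coe_eq_preimage_comap θA (inclHomOfSubset hAW₀ x₀ hxA (hAW₀ hxA)) μ₀ hμ₀
      (inclHomOfSubset hW₀V₀ x₀ (hAW₀ hxA) (hW₀V₀ (hAW₀ hxA))) (inclHomOfSubset hAAH x₀ hxA hxAH)
      (inclHomOfSubset hAHV₀ x₀ hxAH (hAHV₀ hxAH)) hjA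
      (by rw [inclHomOfSubset_comp, inclHomOfSubset_comp])
  · refine MonoidHom.ext fun x => ?_
    have e1 := DFunLike.congr_fun hμ'A x
    simp only [MonoidHom.comp_apply, MulEquiv.coe_toMonoidHom] at e1 ⊢
    rw [e1, inclHomOfSubset_inclHomOfSubset, inclHomOfSubset_inclHomOfSubset]
  · refine MonoidHom.ext fun x => ?_
    have e1 := DFunLike.congr_fun hμ'P x
    simp only [MonoidHom.comp_apply, MulEquiv.coe_toMonoidHom] at e1 ⊢
    rw [e1, inclHomOfSubset_inclHomOfSubset, inclHomOfSubset_inclHomOfSubset]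

end Slot

/-! ### Assembly over `IsGKTrisection`: `𝒢(h′, x₀, μ′) = 𝒢(h, x₀, μ₀) # L` -/

section Assembly

variable {X : Type u} [TopologicalSpace X] [ChartedSpace (EuclideanSpace ℝ (Fin 4)) X]
  {g g' : ℕ}

/-- **The `π₁` stage of a connected-sum step, assembled.**  Let `S` (genus `g`) and `S′`
(genus `g + g'`) be Gay–Kirby trisections of `X` and `x₀ ∈ X`.  Suppose (all sets are subsets
of `X`, all maps of fundamental groups are induced by inclusions): the new central surface is a
closed cover `⋂ l, S′ l = A ∪ P` meeting exactly in `C ∋ x₀` with collars, `A`, `P`, `C` path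
connected, `π₁(C, x₀)` generated by `t`, `A ⊆ ⋂ l, S l`; free bases
`θ_A : F⟨a₁,…,b_g⟩ ≃* π₁(A, x₀)` (`θ_A(r_g) = t`) and `θ_P : F⟨a₁,…,b_{g'}⟩ ≃* π₁(P, x₀)`
(`θ_P(r_{g'}) = t⁻¹`), a marking `μ₀` of the old central surface reading words through `θ_A`;
for each `ι`, the new handlebody is a closed cover `S′(ι+1) ∩ S′(ι+2) = A^H_ι ∪ B^H_ι` over a
simply connected `E_ι ∋ x₀` with collars, `A ⊆ A^H_ι ⊆ S(ι+1) ∩ S(ι+2)`, `P ⊆ B^H_ι`, with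
`π₁ A → π₁(S(ι+1) ∩ S(ι+2))` onto, `π₁ A^H_ι → π₁(S(ι+1) ∩ S(ι+2))` injective, and
`π₁ P → π₁ B^H_ι` onto with kernel (read through `θ_P`) the full preimage of the model kernel
`L_ι ⊆ S_{g'}`.  Then there is a marking `μ′` of the central surface of `S′` at `x₀` with
`𝒢(h′, x₀, μ′) = 𝒢(h, x₀, μ₀) # L` on the nose (Abrams–Gay–Kirby, Def. 2: "connected sums of
group trisections map to connected sums of 4-manifold trisections", at the level of `π₁`,
granted the decomposition). [cite: AbramsGayKirby2018, Def. 2 (p. 1539) and Thm. 5 (p. 1541)]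
[cite: GayKirby2016, Def. 8 and Lemma 10 (p. 3100)] -/
theorem exists_marking_groupGKTrisectionOf_eq_connectSum {k k' : Fin 3 → ℕ}
    {S S' : Fin 3 → Set X} (h : IsGKTrisection X g k S) (h' : IsGKTrisection X (g + g') k' S')
    {x₀ : X}
    -- the new central surface `F′ = A ∪_C P`
    {A P C CA CP OA OP : Set X}
    (hA : IsClosed A) (hP : IsClosed P) (hCA : C ⊆ A) (hCP : C ⊆ P) (hC : A ∩ P ⊆ C)
    (hOA : IsOpen OA) (hCAe : CA = A ∩ OA) (hCCA : C ⊆ CA)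
    (hOP : IsOpen OP) (hCPe : CP = P ∩ OP) (hCCP : C ⊆ CP)
    (hsdrCA : Literature.AlgebraicTopology.Homotopy.IsStrongDeformationRetractOf C CA)
    (hsdrCP : Literature.AlgebraicTopology.Homotopy.IsStrongDeformationRetractOf C CP)
    (hApc : IsPathConnected A) (hPpc : IsPathConnected P) (hCpc : IsPathConnected C)
    (hx₀ : x₀ ∈ C) (eF' : A ∪ P = ⋂ l, S' l) (hAF : A ⊆ ⋂ l, S l)
    (t : _root_.FundamentalGroup C ⟨x₀, hx₀⟩) (ht : Subgroup.closure {t} = ⊤)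
    -- free bases and the old marking
    (θA : FreeGroup (surfaceGen g) ≃* _root_.FundamentalGroup A ⟨x₀, hCA hx₀⟩)
    (θP : FreeGroup (surfaceGen g') ≃* _root_.FundamentalGroup P ⟨x₀, hCP hx₀⟩)
    (hθA : θA (surfaceRelator g) = inclHomOfSubset hCA x₀ hx₀ (hCA hx₀) t)
    (hθP : θP (surfaceRelator g') = (inclHomOfSubset hCP x₀ hx₀ (hCP hx₀) t)⁻¹)
    (μ₀ : SurfaceGroup g ≃* _root_.FundamentalGroup (centralSurface S) ⟨x₀, hAF (hCA hx₀)⟩)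
    (hμ₀ : μ₀.toMonoidHom.comp (PresentedGroup.mk _) =
      (inclHomOfSubset hAF x₀ (hCA hx₀) (hAF (hCA hx₀))).comp θA.toMonoidHom)
    -- the new handlebodies `H′_ι = A^H_ι ∪_{E_ι} B^H_ι`
    (AH BH E CAH CBH OAH OBH : Fin 3 → Set X)
    (hAH : ∀ i, IsClosed (AH i)) (hBH : ∀ i, IsClosed (BH i)) (hEAH : ∀ i, E i ⊆ AH i)
    (hEBH : ∀ i, E i ⊆ BH i) (hE : ∀ i, AH i ∩ BH i ⊆ E i)
    (hOAH : ∀ i, IsOpen (OAH i)) (hCAHe : ∀ i, CAH i = AH i ∩ OAH i) (hECAH : ∀ i, E i ⊆ CAH i)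
    (hOBH : ∀ i, IsOpen (OBH i)) (hCBHe : ∀ i, CBH i = BH i ∩ OBH i) (hECBH : ∀ i, E i ⊆ CBH i)
    (hsdrA : ∀ i, Literature.AlgebraicTopology.Homotopy.IsStrongDeformationRetractOf (E i) (CAH i))
    (hsdrB : ∀ i, Literature.AlgebraicTopology.Homotopy.IsStrongDeformationRetractOf (E i) (CBH i))
    (hAHpc : ∀ i, IsPathConnected (AH i)) (hBHpc : ∀ i, IsPathConnected (BH i))
    (hEpc : ∀ i, IsPathConnected (E i)) (hx₀E : ∀ i, x₀ ∈ E i)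
    (hE1 : ∀ i, Subsingleton (_root_.FundamentalGroup (E i) ⟨x₀, hx₀E i⟩))
    (eH' : ∀ i, AH i ∪ BH i = S' (i + 1) ∩ S' (i + 2))
    (hAAH : ∀ i, A ⊆ AH i) (hAHH : ∀ i, AH i ⊆ S (i + 1) ∩ S (i + 2)) (hPBH : ∀ i, P ⊆ BH i)
    -- the model kernel triple and the geometric `π₁` inputs
    (L : TrisectionKernels g')
    (hsAH : ∀ i, Function.Surjective
      (inclHomOfSubset ((hAAH i).trans (hAHH i)) x₀ (hCA hx₀) (hAHH i (hAAH i (hCA hx₀)))))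
    (hjA : ∀ i, Function.Injective
      (inclHomOfSubset (hAHH i) x₀ (hAAH i (hCA hx₀)) (hAHH i (hAAH i (hCA hx₀)))))
    (hsP : ∀ i, Function.Surjective (inclHomOfSubset (hPBH i) x₀ (hCP hx₀) (hPBH i (hCP hx₀))))
    (hkP : ∀ i, (((inclHomOfSubset (hPBH i) x₀ (hCP hx₀) (hPBH i (hCP hx₀))).comp
        θP.toMonoidHom).ker : Set (FreeGroup (surfaceGen g'))) =
      (PresentedGroup.mk _) ⁻¹' (L i : Set (SurfaceGroup g'))) :
    ∃ (hx₀' : x₀ ∈ ⋂ l, S' l)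
      (μ' : SurfaceGroup (g + g') ≃* _root_.FundamentalGroup (centralSurface S') ⟨x₀, hx₀'⟩),
      groupGKTrisectionOf h' ⟨x₀, hx₀'⟩ μ' =
          (groupGKTrisectionOf h ⟨x₀, hAF (hCA hx₀)⟩ μ₀).connectSum L ∧
        μ'.toMonoidHom.comp ((PresentedGroup.mk _).comp (genInclAdd g g')) =
          (inclHomOfSubset (eF' ▸ subset_union_left) x₀ (hCA hx₀) hx₀').comp θA.toMonoidHom ∧
        μ'.toMonoidHom.comp ((PresentedGroup.mk _).comp (genShiftAdd g g')) =
          (inclHomOfSubset (eF' ▸ subset_union_right) x₀ (hCP hx₀) hx₀').comp θP.toMonoidHom := by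
  -- the marking of the new central surface
  obtain ⟨hxW, hAW, hPW, μ', hμ'A, hμ'P⟩ := exists_marking_of_closed_cover_collars_add hA hP hCA hCP
    hC hOA hCAe hCCA hOP hCPe hCCP hsdrCA hsdrCP hApc hPpc hCpc hx₀ eF' t ht θA θP hθA hθP
  refine ⟨hxW, μ', funext fun i => ?_, hμ'A, hμ'P⟩
  haveI := hE1 i
  have hWV : (⋂ l, S' l) ⊆ S' (i + 1) ∩ S' (i + 2) := iInter_subset_inter S' i
  rw [groupGKTrisectionOf_apply_eq_comap_ker_inclHomOfSubset h' x₀ hxW μ' i]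
  refine comap_ker_eq_connectSum_of_closed_covers (hAH i) (hBH i) (hEAH i) (hEBH i) (hE i) (hOAH i)
    (hCAHe i) (hECAH i) (hOBH i) (hCBHe i) (hECBH i) (hsdrA i) (hsdrB i) (hAHpc i) (hBHpc i)
    (hEpc i) (hx₀E i) (eH' i) (hCA hx₀) (hCP hx₀) hAF (iInter_subset_inter S i) (hAAH i) (hAHH i)
    (hPBH i) hAW hPW hWV θA.toMonoidHom θP.toMonoidHom μ₀ hμ₀ μ' hμ'A hμ'P _ L i ?_ ?_ (hjA i) ?_
    (hkP i)
  · exact groupGKTrisectionOf_apply_eq_comap_ker_inclHomOfSubset h x₀ (hAF (hCA hx₀)) μ₀ i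
  · -- `π₁ A → π₁ A^H_ι` is onto: `π₁ A → π₁ H_ι` is onto and `π₁ A^H_ι → π₁ H_ι` is injective
    rw [MonoidHom.coe_comp, MulEquiv.coe_toMonoidHom]
    refine Function.Surjective.comp (fun y => ?_) θA.surjective
    obtain ⟨x, hx⟩ := hsAH i (inclHomOfSubset (hAHH i) x₀ (hAAH i (hCA hx₀))
      (hAHH i (hAAH i (hCA hx₀))) y)
    refine ⟨x, hjA i ?_⟩
    rw [inclHomOfSubset_inclHomOfSubset, hx]
  · rw [MonoidHom.coe_comp, MulEquiv.coe_toMonoidHom]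
    exact (hsP i).comp θP.surjective

end Assembly

/-! ### Handing the free-basis datum on -/

section Datum

variable {X : Type u} [TopologicalSpace X] {g g' : ℕ}

/-- **The new marking reads words through the glued free basis.**  Let `A, Q ⊆ W′ ⊆ W` and
`Q ⊆ P ⊆ W`, all containing `x₀`.  If `μ′ : S_{g+g'} ≃* π₁(W, x₀)` reads the first `g` handles
through `θ_A` and the last `g'` through `θ_P`, `θ′ : F⟨a₁,…,b_{g+g'}⟩ ≃* π₁(W′, x₀)` reads them
through `θ_A` and `θ_Q ∘ some`, and `θ_Q ∘ some` pushed into `P` is `θ_P`, then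
`μ′ ∘ mk = (W′ ⊆ W)_* ∘ θ′` — hypothesis `hμ₀` of the next step, with `A ↦ W′`, `θ_A ↦ θ′`,
`μ₀ ↦ μ′`. [cite: AbramsGayKirby2018, Def. 2–3 (pp. 1539–1540)] -/
theorem marking_comp_mk_eq_inclHom_comp_freeBasis_add {A Q P W' W : Set X}
    (hAW' : A ⊆ W') (hQW' : Q ⊆ W') (hW'W : W' ⊆ W) (hQP : Q ⊆ P) (hPW : P ⊆ W)
    {x₀ : X} (hxA : x₀ ∈ A) (hxQ : x₀ ∈ Q) (hxP : x₀ ∈ P) (hxW' : x₀ ∈ W') (hxW : x₀ ∈ W)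
    (θA : FreeGroup (surfaceGen g) ≃* _root_.FundamentalGroup A ⟨x₀, hxA⟩)
    (θQ : FreeGroup (Option (surfaceGen g')) ≃* _root_.FundamentalGroup Q ⟨x₀, hxQ⟩)
    (θP : FreeGroup (surfaceGen g') ≃* _root_.FundamentalGroup P ⟨x₀, hxP⟩)
    (θ' : FreeGroup (surfaceGen (g + g')) ≃* _root_.FundamentalGroup W' ⟨x₀, hxW'⟩)
    (h₁ : θ'.toMonoidHom.comp (genInclAdd g g') =
      (inclHomOfSubset hAW' x₀ hxA hxW').comp θA.toMonoidHom)
    (h₂ : θ'.toMonoidHom.comp (genShiftAdd g g') =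
      (inclHomOfSubset hQW' x₀ hxQ hxW').comp (θQ.toMonoidHom.comp (FreeGroup.map some)))
    (hQPθ : (inclHomOfSubset hQP x₀ hxQ hxP).comp (θQ.toMonoidHom.comp (FreeGroup.map some)) =
      θP.toMonoidHom)
    (μ' : SurfaceGroup (g + g') ≃* _root_.FundamentalGroup W ⟨x₀, hxW⟩)
    (hμ'A : μ'.toMonoidHom.comp ((PresentedGroup.mk _).comp (genInclAdd g g')) =
      (inclHomOfSubset (hAW'.trans hW'W) x₀ hxA hxW).comp θA.toMonoidHom)
    (hμ'P : μ'.toMonoidHom.comp ((PresentedGroup.mk _).comp (genShiftAdd g g')) =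
      (inclHomOfSubset hPW x₀ hxP hxW).comp θP.toMonoidHom) :
    μ'.toMonoidHom.comp (PresentedGroup.mk _) =
      (inclHomOfSubset hW'W x₀ hxW' hxW).comp θ'.toMonoidHom := by
  refine freeGroup_hom_ext_add ?_ ?_
  · rw [MonoidHom.comp_assoc, hμ'A, MonoidHom.comp_assoc, h₁, ← MonoidHom.comp_assoc,
      inclHomOfSubset_comp]
  · rw [MonoidHom.comp_assoc, hμ'P, MonoidHom.comp_assoc, h₂, ← MonoidHom.comp_assoc,
      inclHomOfSubset_comp, ← hQPθ, ← MonoidHom.comp_assoc, inclHomOfSubset_comp]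

variable [ChartedSpace (EuclideanSpace ℝ (Fin 4)) X]

/-- **A connected-sum step at the level of `π₁`, with the free-basis datum handed on.**  The
hypotheses up to `hkP` are those of `exists_marking_groupGKTrisectionOf_eq_connectSum`; the
additional data live in the model piece `P ≅ Σ_{g'} ∖ disc`: a closed `Q` with `C ⊆ Q ⊆ P`
(`P` minus the open disc of the NEXT step), a collar of `C` in `Q`, and a free basis
`θ_Q : F⟨Option(a₁,…,b_{g'})⟩ ≃* π₁(Q, x₀)` with `θ_Q(none) = t` whose other members push to
`θ_P` in `P`.  Conclusion: `μ′` with `𝒢(h′, x₀, μ′) = 𝒢(h, x₀, μ₀) # L` ON THE NOSE together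
with a free basis `θ′` of `π₁(A ∪ Q, x₀)` (first `g` handles through `θ_A`, last `g'` through
`θ_Q ∘ some`) through which `μ′` reads — the input datum of the next step
(`exists_freeBasis_union_of_closed_cover_collars`, `marking_comp_mk_eq_inclHom_comp_freeBasis_add`).
[cite: AbramsGayKirby2018, Def. 2–3 (pp. 1539–1540) and Thm. 5 (p. 1541)]
[cite: GayKirby2016, Def. 8 and Lemma 10 (p. 3100)] -/
theorem exists_marking_groupGKTrisectionOf_eq_connectSum_datum {k k' : Fin 3 → ℕ}
    {S S' : Fin 3 → Set X} (h : IsGKTrisection X g k S) (h' : IsGKTrisection X (g + g') k' S')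
    {x₀ : X}
    -- the new central surface `F′ = A ∪_C P`
    {A P C CA CP OA OP : Set X}
    (hA : IsClosed A) (hP : IsClosed P) (hCA : C ⊆ A) (hCP : C ⊆ P) (hC : A ∩ P ⊆ C)
    (hOA : IsOpen OA) (hCAe : CA = A ∩ OA) (hCCA : C ⊆ CA)
    (hOP : IsOpen OP) (hCPe : CP = P ∩ OP) (hCCP : C ⊆ CP)
    (hsdrCA : Literature.AlgebraicTopology.Homotopy.IsStrongDeformationRetractOf C CA)
    (hsdrCP : Literature.AlgebraicTopology.Homotopy.IsStrongDeformationRetractOf C CP)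
    (hApc : IsPathConnected A) (hPpc : IsPathConnected P) (hCpc : IsPathConnected C)
    (hx₀ : x₀ ∈ C) (eF' : A ∪ P = ⋂ l, S' l) (hAF : A ⊆ ⋂ l, S l)
    (t : _root_.FundamentalGroup C ⟨x₀, hx₀⟩) (ht : Subgroup.closure {t} = ⊤)
    -- free bases and the old marking
    (θA : FreeGroup (surfaceGen g) ≃* _root_.FundamentalGroup A ⟨x₀, hCA hx₀⟩)
    (θP : FreeGroup (surfaceGen g') ≃* _root_.FundamentalGroup P ⟨x₀, hCP hx₀⟩)
    (hθA : θA (surfaceRelator g) = inclHomOfSubset hCA x₀ hx₀ (hCA hx₀) t)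
    (hθP : θP (surfaceRelator g') = (inclHomOfSubset hCP x₀ hx₀ (hCP hx₀) t)⁻¹)
    (μ₀ : SurfaceGroup g ≃* _root_.FundamentalGroup (centralSurface S) ⟨x₀, hAF (hCA hx₀)⟩)
    (hμ₀ : μ₀.toMonoidHom.comp (PresentedGroup.mk _) =
      (inclHomOfSubset hAF x₀ (hCA hx₀) (hAF (hCA hx₀))).comp θA.toMonoidHom)
    -- the new handlebodies `H′_ι = A^H_ι ∪_{E_ι} B^H_ι`
    (AH BH E CAH CBH OAH OBH : Fin 3 → Set X)
    (hAH : ∀ i, IsClosed (AH i)) (hBH : ∀ i, IsClosed (BH i)) (hEAH : ∀ i, E i ⊆ AH i)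
    (hEBH : ∀ i, E i ⊆ BH i) (hE : ∀ i, AH i ∩ BH i ⊆ E i)
    (hOAH : ∀ i, IsOpen (OAH i)) (hCAHe : ∀ i, CAH i = AH i ∩ OAH i) (hECAH : ∀ i, E i ⊆ CAH i)
    (hOBH : ∀ i, IsOpen (OBH i)) (hCBHe : ∀ i, CBH i = BH i ∩ OBH i) (hECBH : ∀ i, E i ⊆ CBH i)
    (hsdrA : ∀ i, Literature.AlgebraicTopology.Homotopy.IsStrongDeformationRetractOf (E i) (CAH i))
    (hsdrB : ∀ i, Literature.AlgebraicTopology.Homotopy.IsStrongDeformationRetractOf (E i) (CBH i))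
    (hAHpc : ∀ i, IsPathConnected (AH i)) (hBHpc : ∀ i, IsPathConnected (BH i))
    (hEpc : ∀ i, IsPathConnected (E i)) (hx₀E : ∀ i, x₀ ∈ E i)
    (hE1 : ∀ i, Subsingleton (_root_.FundamentalGroup (E i) ⟨x₀, hx₀E i⟩))
    (eH' : ∀ i, AH i ∪ BH i = S' (i + 1) ∩ S' (i + 2))
    (hAAH : ∀ i, A ⊆ AH i) (hAHH : ∀ i, AH i ⊆ S (i + 1) ∩ S (i + 2)) (hPBH : ∀ i, P ⊆ BH i)
    -- the model kernel triple and the geometric `π₁` inputs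
    (L : TrisectionKernels g')
    (hsAH : ∀ i, Function.Surjective
      (inclHomOfSubset ((hAAH i).trans (hAHH i)) x₀ (hCA hx₀) (hAHH i (hAAH i (hCA hx₀)))))
    (hjA : ∀ i, Function.Injective
      (inclHomOfSubset (hAHH i) x₀ (hAAH i (hCA hx₀)) (hAHH i (hAAH i (hCA hx₀)))))
    (hsP : ∀ i, Function.Surjective (inclHomOfSubset (hPBH i) x₀ (hCP hx₀) (hPBH i (hCP hx₀))))
    (hkP : ∀ i, (((inclHomOfSubset (hPBH i) x₀ (hCP hx₀) (hPBH i (hCP hx₀))).comp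
        θP.toMonoidHom).ker : Set (FreeGroup (surfaceGen g'))) =
      (PresentedGroup.mk _) ⁻¹' (L i : Set (SurfaceGroup g')))
    -- the datum for the next step: the model piece `Q = P ∖ D̊′` and its free basis
    {Q CQ OQ : Set X} (hQ : IsClosed Q) (hCQ : C ⊆ Q) (hQP : Q ⊆ P)
    (hOQ : IsOpen OQ) (hCQe : CQ = Q ∩ OQ) (hCCQ : C ⊆ CQ)
    (hsdrCQ : Literature.AlgebraicTopology.Homotopy.IsStrongDeformationRetractOf C CQ)
    (hQpc : IsPathConnected Q)
    (θQ : FreeGroup (Option (surfaceGen g')) ≃* _root_.FundamentalGroup Q ⟨x₀, hCQ hx₀⟩)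
    (hθQ : θQ (FreeGroup.of none) = inclHomOfSubset hCQ x₀ hx₀ (hCQ hx₀) t)
    (hQPθ : (inclHomOfSubset hQP x₀ (hCQ hx₀) (hCP hx₀)).comp
      (θQ.toMonoidHom.comp (FreeGroup.map some)) = θP.toMonoidHom) :
    ∃ (hx₀' : x₀ ∈ ⋂ l, S' l)
      (μ' : SurfaceGroup (g + g') ≃* _root_.FundamentalGroup (centralSurface S') ⟨x₀, hx₀'⟩)
      (hxAQ : x₀ ∈ A ∪ Q) (hAQF' : A ∪ Q ⊆ ⋂ l, S' l)
      (θ' : FreeGroup (surfaceGen (g + g')) ≃* _root_.FundamentalGroup ↥(A ∪ Q) ⟨x₀, hxAQ⟩),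
      groupGKTrisectionOf h' ⟨x₀, hx₀'⟩ μ' =
          (groupGKTrisectionOf h ⟨x₀, hAF (hCA hx₀)⟩ μ₀).connectSum L ∧
        θ'.toMonoidHom.comp (genInclAdd g g') =
          (inclHomOfSubset subset_union_left x₀ (hCA hx₀) hxAQ).comp θA.toMonoidHom ∧
        θ'.toMonoidHom.comp (genShiftAdd g g') =
          (inclHomOfSubset subset_union_right x₀ (hCQ hx₀) hxAQ).comp
            (θQ.toMonoidHom.comp (FreeGroup.map some)) ∧
        μ'.toMonoidHom.comp (PresentedGroup.mk _) =
          (inclHomOfSubset hAQF' x₀ hxAQ hx₀').comp θ'.toMonoidHom := by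
  obtain ⟨hxW, μ', hK, hμ'A, hμ'P⟩ := exists_marking_groupGKTrisectionOf_eq_connectSum h h' hA hP hCA
    hCP hC hOA hCAe hCCA hOP hCPe hCCP hsdrCA hsdrCP hApc hPpc hCpc hx₀ eF' hAF t ht θA θP hθA hθP
    μ₀ hμ₀ AH BH E CAH CBH OAH OBH hAH hBH hEAH hEBH hE hOAH hCAHe hECAH hOBH hCBHe hECBH hsdrA
    hsdrB hAHpc hBHpc hEpc hx₀E hE1 eH' hAAH hAHH hPBH L hsAH hjA hsP hkP
  have hAW : A ⊆ ⋂ l, S' l := eF' ▸ subset_union_left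
  have hPW : P ⊆ ⋂ l, S' l := eF' ▸ subset_union_right
  -- the glued free basis of `π₁(A ∪ Q, x₀)` and the reading of `μ′` through it
  have hCAQ : A ∩ Q ⊆ C := fun x hx => hC ⟨hx.1, hQP hx.2⟩
  obtain ⟨hxW', hAW', hQW', θ', h₁, h₂⟩ := exists_freeBasis_union_of_closed_cover_collars hA hQ
    hCA hCQ hCAQ hOA hCAe hCCA hOQ hCQe hCCQ hsdrCA hsdrCQ hApc hQpc hCpc hx₀ rfl t ht θA θQ hθQ
  have hAQF' : A ∪ Q ⊆ ⋂ l, S' l := union_subset hAW (hQP.trans hPW)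
  refine ⟨hxW, μ', hxW', hAQF', θ', hK, h₁, h₂, ?_⟩
  exact marking_comp_mk_eq_inclHom_comp_freeBasis_add hAW' hQW' hAQF' hQP hPW (hCA hx₀) (hCQ hx₀)
    (hCP hx₀) hxW' hxW θA θQ θP θ' h₁ h₂ hQPθ μ' hμ'A hμ'P

end Datum

/-! ### One implant: `g' = 1`, `L = unbalancedKernels i` -/

section Implant

variable {X : Type u} [TopologicalSpace X] [ChartedSpace (EuclideanSpace ℝ (Fin 4)) X] {g : ℕ}

/-- **The `π₁` stage of ONE unbalanced stabilisation (implant in sector `i`), with the datum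
handed on.**  Specialisation of `exists_marking_groupGKTrisectionOf_eq_connectSum_datum` to
`g' = 1`: the new piece `P` of the central surface is a one-holed torus with free basis
`θ_P : F⟨a, b⟩ ≃* π₁(P, x₀)` (`a = (0, false)`, `b = (0, true)`), `θ_P(a b a⁻¹ b⁻¹) = t⁻¹`, and
`π₁ P → π₁ B^H_ι` is onto with kernel normally generated by the relator `[a, b]` and ONE
generator: `b` for the slot `ι = i` (the arc closed up in `F` bounds in `H_i ∖ N̊`) and `a` for
the two other slots (the meridian of the tube bounds the cocore disc of the added `1`-handle)
— Gay–Kirby, proof of Lemma 10, one eye.  Conclusion: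
`𝒢(h′, x₀, μ′) = 𝒢(h, x₀, μ₀).stabilizeOne i` ON THE NOSE, with the datum `θ′` for the next
implant. [cite: GayKirby2016, proof of Lemma 10 (arXiv pp. 31–32) and Def. 8]
[cite: AbramsGayKirby2018, Def. 2 (p. 1539)] -/
theorem exists_marking_groupGKTrisectionOf_eq_stabilizeOne_datum {k k' : Fin 3 → ℕ}
    {S S' : Fin 3 → Set X} (h : IsGKTrisection X g k S) (h' : IsGKTrisection X (g + 1) k' S')
    (i : Fin 3) {x₀ : X}
    -- the new central surface `F′ = A ∪_C P`
    {A P C CA CP OA OP : Set X}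
    (hA : IsClosed A) (hP : IsClosed P) (hCA : C ⊆ A) (hCP : C ⊆ P) (hC : A ∩ P ⊆ C)
    (hOA : IsOpen OA) (hCAe : CA = A ∩ OA) (hCCA : C ⊆ CA)
    (hOP : IsOpen OP) (hCPe : CP = P ∩ OP) (hCCP : C ⊆ CP)
    (hsdrCA : Literature.AlgebraicTopology.Homotopy.IsStrongDeformationRetractOf C CA)
    (hsdrCP : Literature.AlgebraicTopology.Homotopy.IsStrongDeformationRetractOf C CP)
    (hApc : IsPathConnected A) (hPpc : IsPathConnected P) (hCpc : IsPathConnected C)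
    (hx₀ : x₀ ∈ C) (eF' : A ∪ P = ⋂ l, S' l) (hAF : A ⊆ ⋂ l, S l)
    (t : _root_.FundamentalGroup C ⟨x₀, hx₀⟩) (ht : Subgroup.closure {t} = ⊤)
    -- free bases and the old marking
    (θA : FreeGroup (surfaceGen g) ≃* _root_.FundamentalGroup A ⟨x₀, hCA hx₀⟩)
    (θP : FreeGroup (surfaceGen 1) ≃* _root_.FundamentalGroup P ⟨x₀, hCP hx₀⟩)
    (hθA : θA (surfaceRelator g) = inclHomOfSubset hCA x₀ hx₀ (hCA hx₀) t)
    (hθP : θP (surfaceRelator 1) = (inclHomOfSubset hCP x₀ hx₀ (hCP hx₀) t)⁻¹)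
    (μ₀ : SurfaceGroup g ≃* _root_.FundamentalGroup (centralSurface S) ⟨x₀, hAF (hCA hx₀)⟩)
    (hμ₀ : μ₀.toMonoidHom.comp (PresentedGroup.mk _) =
      (inclHomOfSubset hAF x₀ (hCA hx₀) (hAF (hCA hx₀))).comp θA.toMonoidHom)
    -- the new handlebodies `H′_ι = A^H_ι ∪_{E_ι} B^H_ι`
    (AH BH E CAH CBH OAH OBH : Fin 3 → Set X)
    (hAH : ∀ ι, IsClosed (AH ι)) (hBH : ∀ ι, IsClosed (BH ι)) (hEAH : ∀ ι, E ι ⊆ AH ι)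
    (hEBH : ∀ ι, E ι ⊆ BH ι) (hE : ∀ ι, AH ι ∩ BH ι ⊆ E ι)
    (hOAH : ∀ ι, IsOpen (OAH ι)) (hCAHe : ∀ ι, CAH ι = AH ι ∩ OAH ι) (hECAH : ∀ ι, E ι ⊆ CAH ι)
    (hOBH : ∀ ι, IsOpen (OBH ι)) (hCBHe : ∀ ι, CBH ι = BH ι ∩ OBH ι) (hECBH : ∀ ι, E ι ⊆ CBH ι)
    (hsdrA : ∀ ι, Literature.AlgebraicTopology.Homotopy.IsStrongDeformationRetractOf (E ι) (CAH ι))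
    (hsdrB : ∀ ι, Literature.AlgebraicTopology.Homotopy.IsStrongDeformationRetractOf (E ι) (CBH ι))
    (hAHpc : ∀ ι, IsPathConnected (AH ι)) (hBHpc : ∀ ι, IsPathConnected (BH ι))
    (hEpc : ∀ ι, IsPathConnected (E ι)) (hx₀E : ∀ ι, x₀ ∈ E ι)
    (hE1 : ∀ ι, Subsingleton (_root_.FundamentalGroup (E ι) ⟨x₀, hx₀E ι⟩))
    (eH' : ∀ ι, AH ι ∪ BH ι = S' (ι + 1) ∩ S' (ι + 2))
    (hAAH : ∀ ι, A ⊆ AH ι) (hAHH : ∀ ι, AH ι ⊆ S (ι + 1) ∩ S (ι + 2)) (hPBH : ∀ ι, P ⊆ BH ι)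
    -- the geometric `π₁` inputs
    (hsAH : ∀ ι, Function.Surjective
      (inclHomOfSubset ((hAAH ι).trans (hAHH ι)) x₀ (hCA hx₀) (hAHH ι (hAAH ι (hCA hx₀)))))
    (hjA : ∀ ι, Function.Injective
      (inclHomOfSubset (hAHH ι) x₀ (hAAH ι (hCA hx₀)) (hAHH ι (hAAH ι (hCA hx₀)))))
    (hsP : ∀ ι, Function.Surjective (inclHomOfSubset (hPBH ι) x₀ (hCP hx₀) (hPBH ι (hCP hx₀))))
    (hkP : ∀ ι, (((inclHomOfSubset (hPBH ι) x₀ (hCP hx₀) (hPBH ι (hCP hx₀))).comp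
        θP.toMonoidHom).ker : Set (FreeGroup (surfaceGen 1))) =
      (normalClosure ({FreeGroup.of (((0 : Fin 1), decide (ι = i)) : surfaceGen 1)} ∪
          {surfaceRelator 1}) : Set (FreeGroup (surfaceGen 1))))
    -- the datum for the next implant: `Q = P ∖ D̊′` and its free basis
    {Q CQ OQ : Set X} (hQ : IsClosed Q) (hCQ : C ⊆ Q) (hQP : Q ⊆ P)
    (hOQ : IsOpen OQ) (hCQe : CQ = Q ∩ OQ) (hCCQ : C ⊆ CQ)
    (hsdrCQ : Literature.AlgebraicTopology.Homotopy.IsStrongDeformationRetractOf C CQ)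
    (hQpc : IsPathConnected Q)
    (θQ : FreeGroup (Option (surfaceGen 1)) ≃* _root_.FundamentalGroup Q ⟨x₀, hCQ hx₀⟩)
    (hθQ : θQ (FreeGroup.of none) = inclHomOfSubset hCQ x₀ hx₀ (hCQ hx₀) t)
    (hQPθ : (inclHomOfSubset hQP x₀ (hCQ hx₀) (hCP hx₀)).comp
      (θQ.toMonoidHom.comp (FreeGroup.map some)) = θP.toMonoidHom) :
    ∃ (hx₀' : x₀ ∈ ⋂ l, S' l)
      (μ' : SurfaceGroup (g + 1) ≃* _root_.FundamentalGroup (centralSurface S') ⟨x₀, hx₀'⟩)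
      (hxAQ : x₀ ∈ A ∪ Q) (hAQF' : A ∪ Q ⊆ ⋂ l, S' l)
      (θ' : FreeGroup (surfaceGen (g + 1)) ≃* _root_.FundamentalGroup ↥(A ∪ Q) ⟨x₀, hxAQ⟩),
      groupGKTrisectionOf h' ⟨x₀, hx₀'⟩ μ' =
          (groupGKTrisectionOf h ⟨x₀, hAF (hCA hx₀)⟩ μ₀).stabilizeOne i ∧
        θ'.toMonoidHom.comp (genInclAdd g 1) =
          (inclHomOfSubset subset_union_left x₀ (hCA hx₀) hxAQ).comp θA.toMonoidHom ∧
        θ'.toMonoidHom.comp (genShiftAdd g 1) =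
          (inclHomOfSubset subset_union_right x₀ (hCQ hx₀) hxAQ).comp
            (θQ.toMonoidHom.comp (FreeGroup.map some)) ∧
        μ'.toMonoidHom.comp (PresentedGroup.mk _) =
          (inclHomOfSubset hAQF' x₀ hxAQ hx₀').comp θ'.toMonoidHom := by
  have hkP' : ∀ ι, (((inclHomOfSubset (hPBH ι) x₀ (hCP hx₀) (hPBH ι (hCP hx₀))).comp
        θP.toMonoidHom).ker : Set (FreeGroup (surfaceGen 1))) =
      (PresentedGroup.mk _) ⁻¹' (unbalancedKernels i ι : Set (SurfaceGroup 1)) := fun ι => by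
    rw [hkP ι, preimage_mk_unbalancedKernels]
  exact exists_marking_groupGKTrisectionOf_eq_connectSum_datum h h' hA hP hCA hCP hC hOA hCAe hCCA
    hOP hCPe hCCP hsdrCA hsdrCP hApc hPpc hCpc hx₀ eF' hAF t ht θA θP hθA hθP μ₀ hμ₀ AH BH E CAH CBH
    OAH OBH hAH hBH hEAH hEBH hE hOAH hCAHe hECAH hOBH hCBHe hECBH hsdrA hsdrB hAHpc hBHpc hEpc hx₀E
    hE1 eH' hAAH hAHH hPBH (unbalancedKernels i) hsAH hjA hsP hkP' hQ hCQ hQP hOQ hCQe hCCQ hsdrCQ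
    hQpc θQ hθQ hQPθ

/-- **Three implants give the balanced stabilisation** (bookkeeping).  If the kernel triples of
three successive marked trisections are obtained from `𝒢₀` by unbalanced stabilisations in
sectors `2`, `1`, `0` (three applications of
`exists_marking_groupGKTrisectionOf_eq_stabilizeOne_datum`), the last one is `𝒢₀.stabilize`
ON THE NOSE (`TrisectionKernels.stabilize_eq_stabilizeOne`) — the identity consumed by the
induction for (d′), `sphere_gkTrisections_of_invariant_step`.
[cite: GayKirby2016, proof of Lemma 10 (arXiv pp. 31–32: "Repeat this for each of the three eyes")]
[cite: AbramsGayKirby2018, Def. 3 (p. 1540)] -/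
theorem groupGKTrisectionOf_eq_stabilize_of_three {k₀ k₁ k₂ k₃ : Fin 3 → ℕ}
    {S₀ S₁ S₂ S₃ : Fin 3 → Set X} (h₀ : IsGKTrisection X g k₀ S₀)
    (h₁ : IsGKTrisection X (g + 1) k₁ S₁) (h₂ : IsGKTrisection X (g + 1 + 1) k₂ S₂)
    (h₃ : IsGKTrisection X (g + 3) k₃ S₃)
    (x₀ : centralSurface S₀) (x₁ : centralSurface S₁) (x₂ : centralSurface S₂)
    (x₃ : centralSurface S₃)
    (μ₀ : SurfaceGroup g ≃* _root_.FundamentalGroup (centralSurface S₀) x₀)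
    (μ₁ : SurfaceGroup (g + 1) ≃* _root_.FundamentalGroup (centralSurface S₁) x₁)
    (μ₂ : SurfaceGroup (g + 1 + 1) ≃* _root_.FundamentalGroup (centralSurface S₂) x₂)
    (μ₃ : SurfaceGroup (g + 3) ≃* _root_.FundamentalGroup (centralSurface S₃) x₃)
    (e₁ : groupGKTrisectionOf h₁ x₁ μ₁ = (groupGKTrisectionOf h₀ x₀ μ₀).stabilizeOne 2)
    (e₂ : groupGKTrisectionOf h₂ x₂ μ₂ = (groupGKTrisectionOf h₁ x₁ μ₁).stabilizeOne 1)
    (e₃ : groupGKTrisectionOf h₃ x₃ μ₃ = (groupGKTrisectionOf h₂ x₂ μ₂).stabilizeOne 0) :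
    groupGKTrisectionOf h₃ x₃ μ₃ = (groupGKTrisectionOf h₀ x₀ μ₀).stabilize := by
  rw [TrisectionKernels.stabilize_eq_stabilizeOne, ← e₁, ← e₂, ← e₃]

end Implant

/-! ### (d′) from an on-the-nose UNBALANCED stabilisation step preserving an invariant -/

section Sphere

/-- **The standard trisections of `S⁴` from an iterable unbalanced stabilisation step.**  Let
`Good` be any property of marked Gay–Kirby trisections `(S, x₀, μ)` of the round `S⁴` of type
`(g; k₀, k₁, k₂)`.  Suppose some marked balanced genus-`0` trisection is `Good`, and that for
each sector `i` every `Good` marked `(g; k)`-trisection admits a `Good` marked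
`(g + 1; k + [· = i])`-trisection whose kernel triple is the unbalanced stabilisation
`𝒢(h, x₀, μ).stabilizeOne i` ON THE NOSE (one implant: Gay–Kirby, proof of Lemma 10, one eye;
its `π₁` stage is `exists_marking_groupGKTrisectionOf_eq_stabilizeOne_datum`).  Then (d′)
`sphere_gkTrisections` holds: three steps in sectors `2, 1, 0` form a balanced step with kernel
triple `𝒢.stabilize` (`TrisectionKernels.stabilize_eq_stabilizeOne`), and
`sphere_gkTrisections_of_invariant_step` iterates it from genus `0` without re-marking.
[cite: GayKirby2016, §2 (arXiv p. 5), Lemma 10 and its proof (arXiv pp. 31–32)]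
[cite: AbramsGayKirby2018, Def. 3 (p. 1540) and Thm. 5 (p. 1541)] -/
theorem sphere_gkTrisections_of_invariant_stabilizeOne_step
    (Good : ∀ (g : ℕ) (k : Fin 3 → ℕ) (S : Fin 3 → Set (Metric.sphere (0 : EuclideanSpace ℝ (Fin 5)) 1))
      (h : IsGKTrisection (Metric.sphere (0 : EuclideanSpace ℝ (Fin 5)) 1) g k S)
      (x₀ : centralSurface S),
      (SurfaceGroup g ≃* _root_.FundamentalGroup (centralSurface S) x₀) → Prop)
    (base : ∃ (S : Fin 3 → Set (Metric.sphere (0 : EuclideanSpace ℝ (Fin 5)) 1))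
      (h : IsBalancedGKTrisection (Metric.sphere (0 : EuclideanSpace ℝ (Fin 5)) 1) 0 0 S)
      (x₀ : centralSurface S)
      (μ : SurfaceGroup 0 ≃* _root_.FundamentalGroup (centralSurface S) x₀),
      Good 0 (fun _ => 0) S h x₀ μ)
    (step : ∀ (i : Fin 3) (g : ℕ) (k : Fin 3 → ℕ)
      (S : Fin 3 → Set (Metric.sphere (0 : EuclideanSpace ℝ (Fin 5)) 1))
      (h : IsGKTrisection (Metric.sphere (0 : EuclideanSpace ℝ (Fin 5)) 1) g k S)
      (x₀ : centralSurface S)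
      (μ : SurfaceGroup g ≃* _root_.FundamentalGroup (centralSurface S) x₀),
      Good g k S h x₀ μ →
        ∃ (S' : Fin 3 → Set (Metric.sphere (0 : EuclideanSpace ℝ (Fin 5)) 1))
          (h' : IsGKTrisection (Metric.sphere (0 : EuclideanSpace ℝ (Fin 5)) 1) (g + 1)
            (Function.update k i (k i + 1)) S')
          (x₀' : centralSurface S')
          (μ' : SurfaceGroup (g + 1) ≃* _root_.FundamentalGroup (centralSurface S') x₀'),
          Good (g + 1) (Function.update k i (k i + 1)) S' h' x₀' μ' ∧
            groupGKTrisectionOf h' x₀' μ' = (groupGKTrisectionOf h x₀ μ).stabilizeOne i) :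
    sphere_gkTrisections := by
  -- transporting `Good` and `𝒢` along an equality of the vectors of `1`-handle counts
  have transport : ∀ {g' : ℕ} {kv kv' : Fin 3 → ℕ} (_ : kv = kv')
      {S' : Fin 3 → Set (Metric.sphere (0 : EuclideanSpace ℝ (Fin 5)) 1)}
      (h' : IsGKTrisection (Metric.sphere (0 : EuclideanSpace ℝ (Fin 5)) 1) g' kv S')
      (x : centralSurface S') (μ : SurfaceGroup g' ≃* _root_.FundamentalGroup (centralSurface S') x),
      Good g' kv S' h' x μ →
        ∃ h'' : IsGKTrisection (Metric.sphere (0 : EuclideanSpace ℝ (Fin 5)) 1) g' kv' S',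
          Good g' kv' S' h'' x μ ∧ groupGKTrisectionOf h'' x μ = groupGKTrisectionOf h' x μ := by
    intro g' kv kv' e
    subst e
    intro S' h' x μ hg
    exact ⟨h', hg, rfl⟩
  refine sphere_gkTrisections_of_invariant_step (fun g k S h x₀ μ => Good g (fun _ => k) S h x₀ μ)
    base ?_
  intro g k S h x₀ μ hg
  -- three implants, in sectors `2`, `1`, `0`
  obtain ⟨S₁, h₁, x₁, μ₁, hg₁, e₁⟩ := step 2 g _ S h x₀ μ hg
  obtain ⟨S₂, h₂, x₂, μ₂, hg₂, e₂⟩ := step 1 (g + 1) _ S₁ h₁ x₁ μ₁ hg₁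
  obtain ⟨S₃, h₃, x₃, μ₃, hg₃, e₃⟩ := step 0 (g + 1 + 1) _ S₂ h₂ x₂ μ₂ hg₂
  -- the counts came back balanced
  have ek : Function.update (Function.update (Function.update (fun _ : Fin 3 => k) 2 (k + 1)) 1
      (Function.update (fun _ : Fin 3 => k) 2 (k + 1) 1 + 1)) 0
      (Function.update (Function.update (fun _ : Fin 3 => k) 2 (k + 1)) 1
        (Function.update (fun _ : Fin 3 => k) 2 (k + 1) 1 + 1) 0 + 1) = fun _ => k + 1 := by
    funext m
    fin_cases m <;> simp
  obtain ⟨h', hg', e'⟩ := transport ek h₃ x₃ μ₃ hg₃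
  refine ⟨S₃, h', x₃, μ₃, hg', ?_⟩
  rw [e', TrisectionKernels.stabilize_eq_stabilizeOne, ← e₁, ← e₂, ← e₃]

end Sphere

/-! ### Adapter: the two-generator kernel of an implant's handlebody chunk -/

section Adapter

/-- **The kernel hypothesis `hkP` of one implant, from two loop facts.**  Let
`φ : F⟨a, b⟩ → G` (in the application `G = π₁(B^H_ι, x₀)`, the new handlebody chunk of an
implant, and `φ = (P ⊆ B^H_ι)_* ∘ θ_P`) kill one generator `x = (0, δ)` and be injective on
the powers of the other, `y = (0, ¬δ)` (e.g. `π₁(B^H_ι) ≅ ℤ` generated by `φ y`: the chunk is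
a `3`-ball with a `1`-handle whose core is `y`, and `x` bounds the cocore disc / the
boundary-parallelism disc).  Then `ker φ` is the normal closure of `x` and the relator
`[a, b]` — the shape of `hkP` in `exists_marking_groupGKTrisectionOf_eq_stabilizeOne_datum`
(`δ = decide (ι = i)`).  Proof: `F⟨a, b⟩ / ⟪x⟫` is generated by the class of `y`, so a word
in the kernel is `yⁿ · m`, `m ∈ ⟪x⟫`, and `φ(y)ⁿ = 1` forces `n = 0`.
[cite: GayKirby2016, proof of Lemma 10 (arXiv pp. 31–32)] [cite: HatcherAT2002, Prop. 1.26] -/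
theorem ker_eq_normalClosure_of_apply_of_eq_one_of_injective_zpow {G : Type*} [Group G]
    (φ : FreeGroup (surfaceGen 1) →* G) (δ : Bool)
    (hx : φ (FreeGroup.of (((0 : Fin 1), δ) : surfaceGen 1)) = 1)
    (hy : Function.Injective fun n : ℤ => φ (FreeGroup.of (((0 : Fin 1), !δ) : surfaceGen 1)) ^ n) :
    (φ.ker : Set (FreeGroup (surfaceGen 1))) =
      (normalClosure ({FreeGroup.of (((0 : Fin 1), δ) : surfaceGen 1)} ∪ {surfaceRelator 1}) :
        Set (FreeGroup (surfaceGen 1))) := by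
  set x : FreeGroup (surfaceGen 1) := FreeGroup.of (((0 : Fin 1), δ) : surfaceGen 1) with hxdef
  set y : FreeGroup (surfaceGen 1) := FreeGroup.of (((0 : Fin 1), !δ) : surfaceGen 1) with hydef
  -- the relator is absorbed
  have hr : surfaceRelator 1 ∈ normalClosure ({x} : Set (FreeGroup (surfaceGen 1))) := by
    simpa using map_surfaceRelator_one_mem_normalClosure (MonoidHom.id (FreeGroup (surfaceGen 1))) δ
  rw [normalClosure_union_singleton_eq_of_mem hr]
  set N : Subgroup (FreeGroup (surfaceGen 1)) := normalClosure {x} with hN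
  refine congrArg SetLike.coe (le_antisymm ?_ ?_)
  · -- `ker φ ≤ ⟪x⟫`
    intro w hw
    rw [MonoidHom.mem_ker] at hw
    -- every class in `F / ⟪x⟫` is a power of the class of `y`
    have hgen : ∀ v : FreeGroup (surfaceGen 1), ∃ n : ℤ, (y ^ n)⁻¹ * v ∈ N := by
      intro v
      have htop : (QuotientGroup.mk' N) v ∈ Subgroup.zpowers ((QuotientGroup.mk' N) y) := by
        have hcl : Subgroup.closure {(QuotientGroup.mk' N) y} = ⊤ := by
          rw [eq_top_iff, ← MonoidHom.range_eq_top.2 (QuotientGroup.mk'_surjective N),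
            MonoidHom.range_eq_map, ← FreeGroup.closure_range_of, MonoidHom.map_closure,
            Subgroup.closure_le]
          rintro _ ⟨_, ⟨⟨j, b⟩, rfl⟩, rfl⟩
          have hj : j = 0 := Subsingleton.elim _ _
          subst hj
          by_cases hb : b = δ
          · subst hb
            have h1 : (QuotientGroup.mk' N) (FreeGroup.of (((0 : Fin 1), b) : surfaceGen 1)) = 1 := by
              rw [QuotientGroup.mk'_apply, QuotientGroup.eq_one_iff]
              exact subset_normalClosure (Set.mem_singleton _)
            rw [h1]
            exact one_mem _
          · have hb' : b = !δ := by cases b <;> cases δ <;> simp_all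
            subst hb'
            exact Subgroup.subset_closure (Set.mem_singleton _)
        rw [Subgroup.zpowers_eq_closure, hcl]
        exact Subgroup.mem_top ((QuotientGroup.mk' N) v)
      obtain ⟨n, hn⟩ := Subgroup.mem_zpowers_iff.1 htop
      refine ⟨n, ?_⟩
      rw [← map_zpow, QuotientGroup.mk'_apply, QuotientGroup.mk'_apply, QuotientGroup.eq] at hn
      exact hn
    obtain ⟨n, hn⟩ := hgen w
    -- `φ w = φ(y)ⁿ`, so `n = 0`
    have hNker : N ≤ φ.ker := normalClosure_le_normal (by
      rintro _ rfl
      exact hx)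
    have h1 : φ ((y ^ n)⁻¹ * w) = 1 := hNker hn
    rw [map_mul, map_inv, map_zpow, hw, mul_one, inv_eq_one] at h1
    have hn0 : n = 0 := hy (by simpa using h1)
    subst hn0
    simpa using hn
  · exact normalClosure_le_normal (by
      rintro _ rfl
      exact hx)

end Adapter

end Literature.Topology.FourManifolds
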